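import Summits.QuantumFields.BalabanUV.T4Continuum.Support.RegionSliceCoerciveBoxTower
import Summits.QuantumFields.BalabanUV.T4Continuum.Support.RegionTentFaceComparison

/-!
# T⁴ programme, spine node NE2 (U1a), sub-row Δ1 «NE2⁰-Dirichlet» — W1 ON EVERY COORDINATE BOX, NO DISPLAYED BINDER:
# `SliceCoercive (curlR n M S) (gradR n M S) (GOm n M a′ S) (QOm n M S) (avgR n M S) (a·n^d) (cW1 d a a′ 4)` for every `IsCoordBox M S`,
# every level `n ≥ 1`, every torus; and the box star tower of the faithful `Δ_a(Ω₀)` modulo W3̃ ONLY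

Row NE2 OWNER item O14-a «Δ1-VEC-W1-BOX» (unit `b2b-balaban-t4-ne2-p1`, gen 14; R30 (c) / R31, journal 2026-08-20 l.19379 / l.20053), file 5
(final junction).  Inputs BY NAME: file 3 `Support/RegionGaugePoincareBox` (p234091: `sliceCoercive_box_of_tent` modulo the displayed
`TentComparison n M S Cf`), file 4 `Support/RegionSliceCoerciveBoxTower` (level-uniform socket + box tower junction), and the SUPPLIER ITEM
«Δ1-VEC-W1-BOX-TENT» DELIVERED by leaf-06-g5: `Support/RegionTentFaceComparison.tent_face_comparison` (p233757, on `Support/RegionTentColumn`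
p233294) — `(n:ℝ)^d·nsq (avgR B − Λ•Φ(B)) ≤ 4·Σ_μ nsq (igrad_μ B)` for EVERY star-bond field, i.e. `TentComparison n M S 4` verbatim.

 * §1 `tentComparison_four : TentComparison n M S 4`.
 * §2 **`sliceCoercive_box (hS : IsCoordBox M S) (hn : 2 ≤ n) (ha : 0 < a) (ha′ : 0 < a′)`** — W1 with the constant `cW1 d a a′ 4`, free of
   `n`, `M` and the box; `sliceCoercive_amon` (every `AtMostOneNeighbour` region); `coercive_regionDeltaA_box`, `opNorm_inv_regionDeltaA_box_le`
   («G(Ω₀) exists with a bound uniform in η and in the box»); **`sliceCoercive_lev_box : ∀ k, SliceCoercive (… lev L k …) (cW1box d a a′ 4)`** —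
   the owner's level-uniform W1 socket DISCHARGED on boxes.
 * §3 THE BOX STAR TOWER MODULO W3̃ ONLY.  **`towerLimitRate_star_renorm_box_sqrt`**: with an injected law at rate `(√L)⁻¹`
   (`‖G_{k+1}J̃_k − J̃_kG_k‖ ≤ C₁·(√L)^{−k}`) the renormalised star tower of `Δ_a(Ω₀)` on a box converges at rate `(√L)⁻¹`
   (leaf-07-g7's `DirichletStarClassPoincare.towerLimitRate_star_renorm_of_interior_class` with W1 := §2 and interior W2 :=
   `RegionInteriorW2.interiorW2_of_slice`, class `CgI_k ≤ CgIbox·(√L)^{2k}`); and `towerLimitRate_star_renorm_box` = file 4's END at the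
   torus rate `L⁻¹` with W1 discharged — KEPT FOR THE RECORD ONLY: leaf-02-g7's «Δ1-VEC-W3̃-SLAB-NOGO» (`DirichletStarRenormSlabNoGo`,
   proposed 2026-08-20 l.20256: the renormalised planting amplifies the outer normal layer by `√L`, `‖T̃_k‖ ≳ n_k^{−1/2}`) makes its `hinj`
   at rate `L⁻¹` UNSATISFIABLE on slabs with `M_i ≥ 3`, so the OPERATIVE box END is the `(√L)⁻¹` one.

HONEST FRAMING (T4-DAG p. 1).  Model level (`U = 1`, ONE region = a coordinate box of unit blocks, ONE averaging scale, finite torus, operator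
norm); [folklore] bookkeeping over landed modules; W1 on boxes is now a THEOREM (no displayed binder); W3̃ (the injected two-level law of the
faithful star tower) stays DISPLAYED — at rate `(√L)⁻¹` (the rate `L⁻¹` is refuted on slabs by leaf-02-g7); W1 on general unions OPEN and FALSE
with one constant on checkerboard unions (F-ne2leaf09g9-1); NOT [B9] (3.16)/(3.23)–(3.27) as printed (no `{Ω_j, a_j}`, no collar mass); NE2 (U1a)
NOT proved; spine PROVED 0/9 unchanged; NOT infinite volume / mass gap / Clay.  HONEST DEPENDENCY: continuum YM on T⁴ ⇐ BetaPertH ∧ nine spine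
estimates (0/9 proved); BetaPertH ⇐ (D1) ∧ (D4) ∧ CAP+tail; G-an2-4 gates asym, D1 and NE2/3/4.  No `sorry`.
-/

noncomputable section

open scoped BigOperators ComplexConjugate Matrix Matrix.Norms.L2Operator
open Finset

namespace Summit.QuantumFields.BalabanUV.T4Continuum.RegionSliceCoerciveBox

open Literature.MathematicalPhysics.QuantumFieldTheory.Balaban1983to89.B5Prop11Plancherel (Tor fine)
open Literature.MathematicalPhysics.QuantumFieldTheory.Balaban1983to89.B5Prop11Lower (nsq nsq_nonneg)
open Literature.MathematicalPhysics.QuantumFieldTheory.Balaban1983to89.B5G183RateUnitTower (lev)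
open Summit.QuantumFields.BalabanUV.T4Continuum
open Summit.QuantumFields.BalabanUV.T4Continuum.SubtypeCompression (Coercive)
open Summit.QuantumFields.BalabanUV.T4Continuum.BackgroundResolventTower (Cpert)
open Summit.QuantumFields.BalabanUV.T4Continuum.CovariantAveragingTower (TowerLimitRate)
open Summit.QuantumFields.BalabanUV.T4Continuum.ScalarAveragedPropagator (gammaPs)
open Summit.QuantumFields.BalabanUV.T4Continuum.ScalarAveragedCompression (sigma0)
open Summit.QuantumFields.BalabanUV.T4Continuum.RegionGaugeSlice (SliceCoercive)
open Summit.QuantumFields.BalabanUV.T4Continuum.RegionScalarCompression (QOm GOm)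
open Summit.QuantumFields.BalabanUV.T4Continuum.RegionGaugeFixedVector (starReg curlR gradR avgR regionDeltaA opNorm_inv_regionDeltaA_le_of_slice)
open Summit.QuantumFields.BalabanUV.T4Continuum.RegionGaugeOrbit (orbitConst)
open Summit.QuantumFields.BalabanUV.T4Continuum.RegionStarBoundaryCharges (AtMostOneNeighbour atMostOneNeighbour_of_isCoordBox)
open Summit.QuantumFields.BalabanUV.T4Continuum.DirichletSubregionRenormTower (JnR AnR)
open Summit.QuantumFields.BalabanUV.T4Continuum.DirichletStarVectorTower (starP gamStar two_le_lev_succ)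
open Summit.QuantumFields.BalabanUV.T4Continuum.DirichletStarClassPoincare (towerLimitRate_star_renorm_of_interior_class)
open Summit.QuantumFields.BalabanUV.T4Continuum.RegionInteriorW2 (CgIbox one_le_CgIbox interiorW2_of_slice)
open Summit.QuantumFields.BalabanUV.T4Continuum.RegionGaugePoincareBox (TentComparison cW1 cW1_pos sliceCoercive_of_tent
  sliceCoercive_box_of_tent coercive_regionDeltaA_box_of_tent)
open Summit.QuantumFields.BalabanUV.T4Continuum.RegionSliceCoerciveBoxTower (cW1box cW1box_pos sliceCoercive_lev_box_of_tent
  towerLimitRate_star_renorm_box_of_tent)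
open Summit.QuantumFields.BalabanUV.T4Continuum.RegionTentFaceComparison (tent_face_comparison)
open Summit.QuantumFields.BalabanUV.Beta.GAN24.DirichletBoxTwoLevel (IsCoordBox)

variable {d : ℕ} (n : ℕ) [NeZero n] (M : Fin d → ℕ) [hM : ∀ μ, NeZero (M μ)] (a a' : ℝ) (S : Tor M → Prop) [DecidablePred S]

/-! ## §1 The tent comparison is leaf-06-g5's theorem -/

/-- **THE DISPLAYED TENT COMPARISON HOLDS WITH `C♭ = 4`** (leaf-06-g5's `tent_face_comparison`, verbatim). [folklore] -/
theorem tentComparison_four : TentComparison n M S 4 := fun B => tent_face_comparison n M S B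

/-! ## §2 W1 on boxes, no displayed binder -/

/-- **W1 ON EVERY `AtMostOneNeighbour` REGION** (`2 ≤ n`, `0 < a`, `0 < a′`): `SliceCoercive … (cW1 d a a′ 4)`. [folklore] -/
theorem sliceCoercive_amon (hH : AtMostOneNeighbour n M S) (hn : 2 ≤ n) (ha : 0 < a) (ha' : 0 < a') :
    SliceCoercive (curlR n M S) (gradR n M S) (GOm n M a' S) (QOm n M S) (avgR n M S) (a * (n : ℝ) ^ d) (cW1 d a a' 4) :=
  sliceCoercive_of_tent n M a a' S hH hn ha ha' (by norm_num) (tentComparison_four n M S)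

/-- **W1 ON EVERY COORDINATE BOX — THE DISPLAYED SLICE INEQUALITY IS A THEOREM**: for every `IsCoordBox M S`, every level `n ≥ 2`, every torus,
`SliceCoercive (curlR n M S) (gradR n M S) (GOm n M a′ S) (QOm n M S) (avgR n M S) (a·n^d) (cW1 d a a′ 4)` with ONE constant
`cW1 d a a′ 4 = orbitConst d a 401 96 / (1 + 4d/σ₀(d,a′))`. [folklore] -/
theorem sliceCoercive_box (hS : IsCoordBox M S) (hn : 2 ≤ n) (ha : 0 < a) (ha' : 0 < a') :
    SliceCoercive (curlR n M S) (gradR n M S) (GOm n M a' S) (QOm n M S) (avgR n M S) (a * (n : ℝ) ^ d) (cW1 d a a' 4) :=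
  sliceCoercive_box_of_tent n M a a' S hS hn ha ha' (by norm_num) (tentComparison_four n M S)

/-- the same as a COERCIVITY constant of the faithful region operator `Δ_a(Ω₀)` on a box, uniform in the level. [folklore] -/
theorem coercive_regionDeltaA_box (hS : IsCoordBox M S) (hn : 2 ≤ n) (ha : 0 < a) (ha' : 0 < a') :
    Coercive (regionDeltaA n M a a' S) (min (orbitConst d a (17 + 96 * 4) 96 / (1 + 4 * d / sigma0 d a') / 2) (1 / (2 * (gammaPs d a')⁻¹))) :=
  coercive_regionDeltaA_box_of_tent n M a a' S hS hn ha ha' (by norm_num) (tentComparison_four n M S)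

/-- **«G(Ω₀) EXISTS WITH A BOUND UNIFORM IN η AND IN THE BOX»**: `‖(Δ_a(Ω₀))⁻¹‖ ≤ (min (cW1/2) (γ′/2))⁻¹` on every coordinate box at every level
`n ≥ 2`. [cite: Balaban1985BackgroundPropagators, (3.27) p.395 (shape: existence of G(Ω₀))] [folklore] -/
theorem opNorm_inv_regionDeltaA_box_le (hS : IsCoordBox M S) (hn : 2 ≤ n) (ha : 0 < a) (ha' : 0 < a') :
    ‖(regionDeltaA n M a a' S)⁻¹‖ ≤ (min (cW1 d a a' 4 / 2) (1 / (2 * (gammaPs d a')⁻¹)))⁻¹ :=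
  opNorm_inv_regionDeltaA_le_of_slice n M a a' S ha' (cW1_pos (d := d) a a' ha ha') (sliceCoercive_box n M a a' S hS hn ha ha')

section Tower

variable (L : ℕ) [NeZero L]

/-- **THE OWNER's LEVEL-UNIFORM W1 SOCKET IS DISCHARGED ON BOXES**: `∀ k, SliceCoercive (… lev L k …) (a·n_k^d) (cW1box d a a′ 4)` (level 0 by
the unit-lattice identity, levels `k ≥ 1` by `sliceCoercive_box`). [folklore] -/
theorem sliceCoercive_lev_box (hL : 2 ≤ L) (hbox : IsCoordBox M S) (ha : 0 < a) (ha' : 0 < a') (k : ℕ) :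
    SliceCoercive (curlR (lev L k) M S) (gradR (lev L k) M S) (GOm (lev L k) M a' S) (QOm (lev L k) M S) (avgR (lev L k) M S)
      (a * ((lev L k : ℕ) : ℝ) ^ d) (cW1box d a a' 4) :=
  sliceCoercive_lev_box_of_tent L M a a' S hL hbox ha ha' (by norm_num) (fun j => tentComparison_four (lev L (j + 1)) M S) k

/-! ## §3 The box star tower modulo W3̃ only -/

/-- **THE RENORMALISED STAR TOWER OF `Δ_a(Ω₀)` ON A BOX AT RATE `(√L)⁻¹`, MODULO W3̃ AT RATE `(√L)⁻¹` ONLY** — the operative box END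
(W1 := `sliceCoercive_lev_box`, interior W2 := leaf-07-g7's `interiorW2_of_slice`, class Poincaré := leaf-07-g7's
`towerLimitRate_star_renorm_of_interior_class` in the class `CgI_k ≤ CgIbox·(√L)^{2k}`). [folklore] -/
theorem towerLimitRate_star_renorm_box_sqrt (hL : 2 ≤ L) (hbox : IsCoordBox M S) (ha : 0 < a) (ha' : 0 < a') {C₁ : ℝ}
    (hinj : ∀ k, ‖(regionDeltaA (lev L (k + 1)) M a a' S)⁻¹ * JnR L M (starP L M S) k
        - JnR L M (starP L M S) k * (regionDeltaA (lev L k) M a a' S)⁻¹‖ ≤ C₁ * ((Real.sqrt L)⁻¹) ^ k) :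
    TowerLimitRate (AnR L M (starP L M S)) ((L : ℝ) ^ d) (fun k => (regionDeltaA (lev L k) M a a' S)⁻¹)
      (Cpert 0 (Real.sqrt (CgIbox d a' (cW1box d a a' 4) / 2 * (gamStar d a' (cW1box d a a' 4))⁻¹)) C₁ 0 0 0) ((Real.sqrt L)⁻¹) := by
  have hc := cW1box_pos (d := d) a a' (Cf := 4) ha ha'
  have hL1 : (1 : ℝ) < Real.sqrt L := by
    rw [show (1 : ℝ) = Real.sqrt 1 from Real.sqrt_one.symm]
    exact Real.sqrt_lt_sqrt zero_le_one (by exact_mod_cast hL)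
  have hθ0 : (0 : ℝ) ≤ (Real.sqrt L)⁻¹ := by positivity
  have hθ1 : (Real.sqrt L)⁻¹ < 1 := inv_lt_one_of_one_lt₀ hL1
  have hLθ : (L : ℝ) * (Real.sqrt L)⁻¹ = Real.sqrt L := by
    have hs : Real.sqrt L ≠ 0 := by positivity
    field_simp
    rw [Real.sq_sqrt (by positivity)]
  refine towerLimitRate_star_renorm_of_interior_class L M S a a' ha' hc (sliceCoercive_lev_box M a a' S L hL hbox ha ha')
    (CgI := fun _ => CgIbox d a' (cW1box d a a' 4)) (CgI₀ := CgIbox d a' (cW1box d a a' 4)) hθ0 hθ1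
    (fun _ => zero_le_one.trans (one_le_CgIbox (d := d) a' ha' hc)) (fun k => ?_)
    (fun k A => interiorW2_of_slice (lev L (k + 1)) M a a' S (two_le_lev_succ L hL k) hbox ha.le ha' hc
      (sliceCoercive_lev_box M a a' S L hL hbox ha ha' (k + 1)) A) hinj
  -- the constant class sits inside `CgIbox·((L·θ)^k)²` since `L·θ = √L ≥ 1`
  rw [hLθ]
  have h1 : (1 : ℝ) ≤ (Real.sqrt L ^ k) ^ 2 := one_le_pow₀ (one_le_pow₀ hL1.le)
  have h0 : 0 ≤ CgIbox d a' (cW1box d a a' 4) := zero_le_one.trans (one_le_CgIbox (d := d) a' ha' hc)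
  nlinarith

/-- the box END of file 4 at the torus rate `L⁻¹` with W1 discharged — FOR THE RECORD ONLY: its injected law `hinj` at rate `L⁻¹` is
UNSATISFIABLE on slabs with `M_i ≥ 3` by leaf-02-g7's `DirichletStarRenormSlabNoGo.not_renorm_injected_torus_rate` (the renormalised planting
amplifies the outer normal layer by `√L`); the operative END is `towerLimitRate_star_renorm_box_sqrt`. [folklore] -/
theorem towerLimitRate_star_renorm_box (hL : 2 ≤ L) (hbox : IsCoordBox M S) (ha : 0 < a) (ha' : 0 < a') {C₁ : ℝ}
    (hinj : ∀ k, ‖(regionDeltaA (lev L (k + 1)) M a a' S)⁻¹ * JnR L M (starP L M S) k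
        - JnR L M (starP L M S) k * (regionDeltaA (lev L k) M a a' S)⁻¹‖ ≤ C₁ * ((L : ℝ)⁻¹) ^ k) :
    TowerLimitRate (AnR L M (starP L M S)) ((L : ℝ) ^ d) (fun k => (regionDeltaA (lev L k) M a a' S)⁻¹)
      (Cpert 0 (Real.sqrt (CgIbox d a' (cW1box d a a' 4) / 2 * (gamStar d a' (cW1box d a a' 4))⁻¹)) C₁ 0 0 0) ((L : ℝ)⁻¹) :=
  towerLimitRate_star_renorm_box_of_tent L M a a' S hL hbox ha ha' (by norm_num) (fun j => tentComparison_four (lev L (j + 1)) M S) hinj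

end Tower

end Summit.QuantumFields.BalabanUV.T4Continuum.RegionSliceCoerciveBox

end
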